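import Literature.AnabelianGeometry.SemiGraphs.Commensurability

/-!
# Morphisms of semi-graphs of anabelioids as a 1-category ([SemiAnbd] §2, Remark 2.4.2, p. 26)

Mochizuki, *Semi-graphs of anabelioids*, Publ. RIMS **42** (2006) 221–322, §2, Remark 2.4.2,
author's manuscript pp. 26–27 [cite: MochizukiSemiAnbd2006, Rem. 2.4.2 pp.26-27]: a morphism
`φ : 𝒢 → ℋ` of semi-graphs of anabelioids of injective type is a 1-morphism (components `φ_v`,
`φ_e` and 2-isomorphisms `φ_b`); "the 1-morphisms from `𝒢` to `ℋ` form a category … one can then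
speak of isomorphisms between various objects of this category"; and its displayed claims as
NAMED FACTS — the second display ("the isomorphism class of `φ` is completely determined by the
isomorphism class of the `φ_v`") is author-withdrawn ([IUTchI] Remark 2.5.3 (iii): "false as
stated", Dehn twists) and is NOT typed; its printed replacement is `remark_2_5_3_iii` (the `φ_v`
determine each `φ_e` up to isomorphism and each `φ_b` up to an automorphism of `𝒢_e → ℋ_f`); the
third display (verticially slim ⇒ "`φ` has no nontrivial automorphisms") is `remark_2_4_2_rigid`.

Rendering (after referee PASS-A6, F1).  Morphisms over a FIXED morphism `f` of underlying
semi-graphs (`HomOver f`, repackaging `SemiGraphOfAnabelioids.Hom`) so that 2-cells need no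
transport; a 2-cell (`HomOver.Iso2`) consists of isomorphisms of the vertex and edge components
COMPATIBLE WITH THE `φ_b` (the print's category of 1-morphisms); both claims carry the
hypothesis `EveryEdgeAbuts` ("every edge abuts to at least one vertex", which [IUTchI] Remark 2.5.3
(iii) says "it is necessary to assume further" here): for a vertexless isolated edge with
`𝒢_e = B(Ẑ)` the hypotheses are vacuous and the identity has central 2-automorphisms.
-/

namespace Literature.AnabelianGeometry.SemiGraphs

open CategoryTheory CategoryTheory.Limits CategoryTheory.PreGaloisCategory
open Literature.AnabelianGeometry.Anabelioids

universe v₁ u₁ u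

namespace SemiGraphOfAnabelioids

variable {𝒢 : SemiGraphOfAnabelioids.{v₁, u₁, u}}

/-- A 1-morphism of semi-graphs of anabelioids *over a fixed morphism `f` of underlying semi-graphs*:
the components `φ_v`, `φ_e`, `φ_b` of [SemiAnbd] Remark 2.4.2 (so that 2-cells between morphisms
over the same `f` can be stated without transport; `HomOver.toHom` repackages it as a `Hom`).
[cite: MochizukiSemiAnbd2006, Rem. 2.4.2 p.26] -/
structure HomOver (𝒢 ℋ : SemiGraphOfAnabelioids.{v₁, u₁, u}) (f : 𝒢.graph ⟶ ℋ.graph) where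
  /-- the vertex components `φ_v : 𝒢_v → ℋ_{f v}` -/
  φV : ∀ v : 𝒢.graph.Vertex, Anabelioids.Hom (𝒢.V v) (ℋ.V (f.vertexMap v))
  /-- the edge components `φ_e : 𝒢_e → ℋ_{e'}` for `e'` the image of `e` -/
  φE : ∀ (e : 𝒢.graph.Edge) (e' : ℋ.graph.Edge), f.edgeMap e = e' →
    Anabelioids.Hom (𝒢.E e) (ℋ.E e')
  /-- the 2-isomorphisms `φ_b` -/
  φB : ∀ (b : 𝒢.graph.Branch) (v : 𝒢.graph.Vertex) (h : 𝒢.graph.abuts b = some v),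
    (φV v).pullback ⋙ (𝒢.pull b v h).pullback ≅
      (ℋ.pull (f.branchMap b) (f.vertexMap v) (f.abuts_branchMap b v h)).pullback ⋙
        (φE (𝒢.graph.edgeOf b) (ℋ.graph.edgeOf (f.branchMap b)) (f.edgeOf_branchMap b).symm).pullback

/-- Repackaging a morphism over `f` as a morphism. [cite: MochizukiSemiAnbd2006, Rem. 2.4.2 p.26] -/
def HomOver.toHom {ℋ : SemiGraphOfAnabelioids.{v₁, u₁, u}} {f : 𝒢.graph ⟶ ℋ.graph}
    (φ : HomOver 𝒢 ℋ f) : Hom 𝒢 ℋ :=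
  { base := f, φV := φ.φV, φE := φ.φE, φB := φ.φB }

/-- The components of a morphism, as a morphism over its base. [cite: MochizukiSemiAnbd2006, Rem. 2.4.2 p.26] -/
def Hom.over {ℋ : SemiGraphOfAnabelioids.{v₁, u₁, u}} (φ : Hom 𝒢 ℋ) : HomOver 𝒢 ℋ φ.base :=
  { φV := φ.φV, φE := φ.φE, φB := φ.φB }

/-- An *isomorphism* (2-cell) between 1-morphisms `φ, φ'` over the same morphism of semi-graphs, in
"the category of 1-morphisms from `𝒢` to `ℋ`" of [SemiAnbd] Remark 2.4.2: isomorphisms of the vertex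
and edge components COMPATIBLE WITH THE `φ_b` (the squares along every abutting branch commute).
[cite: MochizukiSemiAnbd2006, Rem. 2.4.2 p.26] -/
structure HomOver.Iso2 {ℋ : SemiGraphOfAnabelioids.{v₁, u₁, u}} {f : 𝒢.graph ⟶ ℋ.graph}
    (φ φ' : HomOver 𝒢 ℋ f) where
  /-- isomorphisms of the vertex components -/
  isoV : ∀ v, (φ.φV v).pullback ≅ (φ'.φV v).pullback
  /-- isomorphisms of the edge components -/
  isoE : ∀ (e : 𝒢.graph.Edge) (e' : ℋ.graph.Edge) (h : f.edgeMap e = e'),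
    (φ.φE e e' h).pullback ≅ (φ'.φE e e' h).pullback
  /-- compatibility with the `φ_b`: for every branch `b` abutting to `v`,
  `φ_b ≫ (ℋ.pull ◁ isoE) = (isoV ▷ 𝒢.pull) ≫ φ'_b` -/
  coh : ∀ (b : 𝒢.graph.Branch) (v : 𝒢.graph.Vertex) (h : 𝒢.graph.abuts b = some v),
    φ.φB b v h ≪≫ Functor.isoWhiskerLeft _ (isoE (𝒢.graph.edgeOf b)
        (ℋ.graph.edgeOf (f.branchMap b)) (f.edgeOf_branchMap b).symm) =
      Functor.isoWhiskerRight (isoV v) (𝒢.pull b v h).pullback ≪≫ φ'.φB b v h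

variable (𝒢) in
/-- Non-degeneracy used in Remark 2.4.2: every edge of the underlying semi-graph has at least one
abutting branch (no vertexless isolated edge), so that every edge component is tied to a vertex
component by some `φ_b` — the mechanism the print invokes ("it follows formally from the
definitions [cf. also [Mzk4], Corollary 1.1.6]"); without it the two displayed claims fail (an
isolated edge with `𝒢_e = B(Ẑ)` has central 2-automorphisms). [cite: MochizukiSemiAnbd2006, Rem. 2.4.2 p.26] -/
def EveryEdgeAbuts : Prop :=
  ∀ e : 𝒢.graph.Edge, ∃ (b : 𝒢.graph.Branch) (v : 𝒢.graph.Vertex),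
    𝒢.graph.edgeOf b = e ∧ 𝒢.graph.abuts b = some v

/-- REPLACES the author-withdrawn second display of [SemiAnbd] Remark 2.4.2 ("the isomorphism
class of `φ` is completely determined by the isomorphism class of the `φ_v`" — [IUTchI] Remark 2.5.3
(iii): "false as stated … “Dehn twists” constitute a well-known counterexample … should be replaced
by the following slightly modified version"): "The isomorphism classes of the `φ_v` completely
determine the isomorphism class of each of the `φ_e`, as well as each isomorphism `φ_b`, up to
composition with an automorphism of the composite 1-morphism of anabelioids `𝒢_e → ℋ_f → ℋ_w` that
arises from an automorphism of the 1-morphism of anabelioids `𝒢_e → ℋ_f`."  NAMED FACT, for locally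
open `φ, φ'` over the same `f` between totally aloof semi-graphs of anabelioids of injective type in
which every edge abuts to at least one vertex (the hypothesis [IUTchI] Rmk 2.5.3 (iii) adds for the
surrounding discussion; without it an isolated edge refutes the display): if `φ_v ≅ φ'_v` for all
`v`, then `φ_e ≅ φ'_e` for all `e`, and for every branch `b` there are identifications
`α : φ_v ≅ φ'_v`, `β : φ_e ≅ φ'_e` and an automorphism `γ` of `φ_e` (whiskered by `(f b)^*`, i.e. an
automorphism of `𝒢_e → ℋ_f → ℋ_w` arising from one of `𝒢_e → ℋ_f`) with
`φ'_b = (α ▷ b^*)⁻¹ ≫ φ_b ≫ ((f b)^* ◁ (γ ≫ β))`.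
KERNEL STATUS: PROVED as typed — `remark_2_5_3_iii_holds` (L3-t12, `MorphismRigidityProofs.lean`,
via the two-arrow form of [GeoAn] Cor. 1.1.6 and π₁-mono descent); likewise the third display,
`remark_2_4_2_rigid_holds`.  The `claim … status: disputed` tag below is the cell's uniform provenance
marker for [IUTchI]-sourced text, not an assessment of this (now kernel-checked) statement.
[cite: Mochizuki2012, IUTchI Rmk 2.5.3 (iii), p.54] [claim: Mochizuki2012, status: disputed]
[cite: MochizukiSemiAnbd2006, Comments (May 2020) (9.)] -/
def remark_2_5_3_iii : Prop :=
  ∀ (𝒢 ℋ : SemiGraphOfAnabelioids.{v₁, u₁, u}) (f : 𝒢.graph ⟶ ℋ.graph) (φ φ' : HomOver 𝒢 ℋ f),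
    𝒢.EveryEdgeAbuts → 𝒢.IsOfInjectiveType → ℋ.IsOfInjectiveType → 𝒢.IsTotallyAloof →
    ℋ.IsTotallyAloof → φ.toHom.IsLocallyOpen → φ'.toHom.IsLocallyOpen →
    (∀ v, Nonempty ((φ.φV v).pullback ≅ (φ'.φV v).pullback)) →
    (∀ (e : 𝒢.graph.Edge) (e' : ℋ.graph.Edge) (h : f.edgeMap e = e'),
        Nonempty ((φ.φE e e' h).pullback ≅ (φ'.φE e e' h).pullback)) ∧
      ∀ (b : 𝒢.graph.Branch) (v : 𝒢.graph.Vertex) (h : 𝒢.graph.abuts b = some v),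
        ∃ (α : (φ.φV v).pullback ≅ (φ'.φV v).pullback)
          (β : (φ.φE (𝒢.graph.edgeOf b) (ℋ.graph.edgeOf (f.branchMap b))
              (f.edgeOf_branchMap b).symm).pullback ≅
            (φ'.φE (𝒢.graph.edgeOf b) (ℋ.graph.edgeOf (f.branchMap b))
              (f.edgeOf_branchMap b).symm).pullback)
          (γ : (φ.φE (𝒢.graph.edgeOf b) (ℋ.graph.edgeOf (f.branchMap b))
              (f.edgeOf_branchMap b).symm).pullback ≅
            (φ.φE (𝒢.graph.edgeOf b) (ℋ.graph.edgeOf (f.branchMap b))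
              (f.edgeOf_branchMap b).symm).pullback),
          φ'.φB b v h = (Functor.isoWhiskerRight α (𝒢.pull b v h).pullback).symm ≪≫ φ.φB b v h ≪≫
            Functor.isoWhiskerLeft _ (γ ≪≫ β)

/-- NAMED FACT, [SemiAnbd] Remark 2.4.2, third display: for locally open morphisms `φ` between
totally aloof, verticially slim semi-graphs of anabelioids (of injective type; every edge abutting to
a vertex — the hypothesis [IUTchI] Remark 2.5.3 (iii) adds "in the discussion following this
assertion"), "the 1-morphism `φ` has no nontrivial automorphisms": every 2-automorphism of `φ` (in the
category of 1-morphisms, i.e. compatible with the `φ_b`) has identity components.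
[cite: MochizukiSemiAnbd2006, Rem. 2.4.2 p.26] -/
def remark_2_4_2_rigid : Prop :=
  ∀ (𝒢 ℋ : SemiGraphOfAnabelioids.{v₁, u₁, u}) (f : 𝒢.graph ⟶ ℋ.graph) (φ : HomOver 𝒢 ℋ f),
    𝒢.EveryEdgeAbuts → 𝒢.IsOfInjectiveType → ℋ.IsOfInjectiveType → 𝒢.IsTotallyAloof →
    ℋ.IsTotallyAloof → 𝒢.IsVerticiallySlim → ℋ.IsVerticiallySlim → φ.toHom.IsLocallyOpen →
    ∀ σ : HomOver.Iso2 φ φ, (∀ v, σ.isoV v = Iso.refl _) ∧ ∀ e e' h, σ.isoE e e' h = Iso.refl _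

end SemiGraphOfAnabelioids

end Literature.AnabelianGeometry.SemiGraphs
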